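import Summits.QuantumFields.QCD.Theses.NestedDissectionSea
import Summits.QuantumFields.QCD.Theorems.GluonicCompletion.Negative.Threshold
import Summits.QuantumFields.QCD.Theorems.TiltedFlatness.Negative.MasslessKernel

/-!
# Disproof of `SeaFactorisationBridge` (crux, rank 5, route `NestedDissectionSea`;
# item stmt-QuantumFields-13880) — findings of the standing disprover

Work file of the standing disprover (unit `cdisprove-stmt-QuantumFields-13880`; cycle 1
2026-08-16T00:20Z–01:33Z, cycle 2 (g2) from 2026-08-16T01:34Z).  `lean check`: rc 0, 0 sorries, 0 warnings,
axioms ⊆ {propext, Classical.choice, Quot.sound}.  Three one-shot crux-attack seats preceded this unit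
(g47-3, rattack-13880 g1/g2, rattack-13902; item notes 2026-08-15T22:54Z–23:07Z); their Lean certificates
live on the gate box and are NOT readable from the compute-free hub, so their content was RE-CREATED in
cycle 1 (§1, §4, with credit) and EXTENDED (§2, §3, §5 in cycle 1; §6, §7, §8 in cycle 2).  Everything
conclusive is also filed as support lemmas under `Summits/QuantumFields/QCD/Theorems/SeaFactorisationBridge/Negative/`
(all `--supports stmt-QuantumFields-13880`; LANDED in cycle 1: p73510 `RobustYangMillsContainsYM.lean`
@87e54093cc9f, p73516 `SupSmallCone.lean` @4378230c8f57, p73524 `DiluteSignModels.lean` @6d9adb85fa82,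
p73529 `RegPrefixOffBranch.lean` @5f786d237bf9, p73861 `KillProfile.lean` @996f82c73009; cycle-2 proposals
p75809 `SubsequenceObstruction.lean` (§6, ACCEPTED @875de0ce97db) and p76765 `CouplingMismatch.lean` (§8, ACCEPTED @c49dfca97172;
resubmission of p76508, which bounced only because the gate restarted in flight) — all importable as `Summits.QuantumFields.QCD.Theorems.SeaFactorisationBridge.Negative.<File>`).

## Verdict (cycles 1–2): NO KILL, and none is possible short of refuting the summit conjunct

* §1 `bridge_iff` / `not_bridge_iff` (re-creation): the crux is EXACTLY
  `RobustYangMills → CoerciveSea → QCD` (the conclusion is the threshold reading of `QCDOf 2 ∧ QCDOf 3`,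
  `conclusion_iff_qcd`, via the landed `Negative.qcdOf_iff_threshold`), so
  `¬ SeaFactorisationBridge ↔ RobustYangMills ∧ CoerciveSea ∧ ¬ QCD`: a disproof needs BOTH open cruxes
  proved AND the audited sub-problem statement `QCD` refuted.  `QCD → SeaFactorisationBridge` with the
  hypotheses unused (`bridge_of_qcd`); vacuity directions `bridge_of_not_robustYangMills`,
  `bridge_of_not_coerciveSea` (a refutation of 13897 or 13901 closes the crux trivially and the ROUTE).
  Cycle 2 re-read the summit side for junk-falsity of `QCD` itself (the only direction left):
  `HasLatticeMassGap` is a ratio of SIGNED Grassmann–gauge integrals (`qcdTorusExpect`, junk `0/0 = 0`),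
  quantified over all tori `S ≥ L_k` with `L_k` witness data (`a_k L_k → ∞`), `C` per observable pair,
  `n ≤ S` the short way round the time-periodic torus; `IsNontrivial (pseudoRe f g)` is met by heavy-heavy
  mesons at every finite mass; no internal inconsistency found — and even `¬QCD` would not give `¬S`
  without proofs of 13897 and 13901 (§1).
* §3 (cycle 1, certified): `yangMillsSU3_of_robustYangMills : OddTorusWilsonRP → RobustYangMills →
  YangMillsBodySU3` — hypothesis 1 CONTAINS the summit conjunct `YangMills` at `G = SU(3)` (instantiate
  at `W ≡ 0` along `a_k = 1/(k+1)`, reindex along the returned subsequence `φ`), modulo reflection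
  positivity of Wilson's measure on ODD tori.  So hypothesis 1 is not junk-true unless `YangMills` is
  junk-provable at `SU(3)`; junk-FALSE directions of 13897 need quantitative lattice estimates (LGAP/LIP
  failures for an admissible `W`) that Lean cannot host today — recorded, not pursued.
* §2 (cycle 1, finite models): `dilute_marginals_zero_sign` — one-cell defect marginals `1/(2n) → 0` are
  compatible with a quenched sign average EXACTLY `0`; `independent_defects_sign_average` — independent
  dilute defects give `⟨sign⟩₊ = (1−2δ)ⁿ`.  Step (3) of the informal mechanism needs a DECORRELATION /
  mixing input on the defect field under the phase-quenched measure which NEITHER hypothesis states.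
* §4 (cycle 1, re-creation of rattack-13902): `abs_total_sub_total_le` — the admissible cone of
  `RobustYangMills` is sup-small (`O(η)` per physical block, `→ 0` per site), the sea oscillates by `O(1)`
  per site; `signedWeight_ne_boltzmann` / `quenchedWeight_ne_boltzmann` — neither the signed nor the
  phase-quenched sea is `c·e^{−β′S_W−W}` for ANY `W, β′, c`: `RobustYangMills` cannot be INSTANTIATED on
  the sea through its measures; OUTPUT (1) of the informal text does not type-check as stated.
* §5 (cycle 1): `prefix_reg_offBranch` — the `∃ reg` of the conclusion is load-bearing (branch clause
  `m_f(k) > −1` of `IsQCDAlong` is not in `CoerciveSea`'s prefix).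
* §6 (cycle 2, NEW, definition-free): `∀ W ∃ φ` versus `∃ reg ∀ m`.  `RobustYangMills` returns, for each
  admissible `W` (think: the sea at mass tuple `m` after the bosonic flow), a `W`-DEPENDENT subsequence
  `φ` along which lattice Schwinger functions converge; the conclusion fixes ONE `reg` (one sequence of
  spacings) BEFORE `m` and demands FULL-sequence convergence `IsQCDAlong (reg.scheme m …)` for EVERY real
  mass tuple `m`.  `subseq_tendsto_not_tendsto`: subsequential convergence is not convergence;
  `no_common_subsequence`: a two-valued family indexed by uncountably many parameters, each member with
  convergent subsequences, admits NO common subsequence along which all members converge (parity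
  witness).  Hence any proof must add either (U) UNIQUENESS of the continuum limit in the cone
  (universality — not asserted by `RobustYangMills`, whose `T` may depend on `φ`), or (E) EQUICONTINUITY
  in `m` of all lattice Schwinger functions uniformly in `k` (a volume-summed `ψ̄ψ`-insertion bound, the
  flavour-singlet scalar channel controlled by the gap, AFTER `m`-dependent species renormalisation: with
  `m`-independent `z, shift` the contact terms of `tr F² × ψ̄ψ` make `∂S/∂m` UV-divergent — the statement's
  own mixing caveat, audit g3 N1; `z, shift` are chosen after `m`, so this is allowed but must be done) plus
  a diagonal extraction over a countable dense set of mass tuples — a bridge-internal theorem in either case.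
* §8 (cycle 2, NEW, over the tree's `afBeta`/`betaCoeff₀`/`betaCoeff₁`): THE COUPLING MISMATCH.
  `RobustYangMills` is stated along PURE-GAUGE two-loop profiles (`β′_k − afBeta 0 Λ′ a_k → 0`), the
  conclusion's `IsQCDAlong` demands the `N_f`-flavour profile of the SAME scheme
  (`reg.β_k − afBeta N_f Λ a_k → 0`).  `tendsto_afBeta_zero_sub_afBeta_atTop`: for `N_f ≥ 1` the two profiles
  drift apart like `(N_f/12π²) log a_k⁻²` (`two_mul_betaCoeff₀_zero_sub`); `not_both_asymptotic_scalings` /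
  `scheme_beta_not_pureGauge` / `isQCDAlong_beta_not_pureGauge`: NO coupling sequence serves both — in
  particular the natural strengthening "apply `RobustYangMills` at the QCD scheme's own couplings
  `β′ := reg.β`" has a FALSE premise for every `Λ′`, the hypothesis then yields nothing;
  `shift_tendsto_atTop`: the hand-over couplings must be shifted by `β′_k − reg.β_k → +∞`;
  `residual_after_oneLoop_shift_tendsto_atTop` / `oneLoop_shift_not_pureGauge` with `betaRatio_two_lt_zero` /
  `betaRatio_three_lt_zero`: even after the exact one-loop counterterm and ANY constant (the freedom `Λ′(Λ, M, N_f)` of heavy-quark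
  decoupling — Athenodorou et al. 2019, §3: `Λ_ℓ/Λ_q = P(M/Λ_q)` up to `O((Λ/M)²)`), the mismatch still
  diverges like `2(b₁(0)/b₀(0) − b₁(N_f)/b₀(N_f)) log log a_k⁻²` (the bracket is `428/319`, `214/99` in
  units of `1/16π²` for `N_f = 2, 3`).  So step (1) "bosonic sea flow" must deliver the sea's contribution to the running
  coupling with TWO-LOOP accuracy and `o(1)` error in `β = 2/g₀²`, uniformly along the scheme — a
  renormalised, two-loop-exact multiscale bound for determinant activities (the informal text's own
  "never done" item, now with the exact target
  `β′_k = reg.β_k + (N_f/12π²) log a_k⁻² + 2(b₁⁰/b₀⁰ − b₁ᴺ/b₀ᴺ) log log a_k⁻² + C + o(1)`).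
* §7 (cycle 2): audit of the eight round-1 crux-idea cards' first lemmas (details in the §7 docblock):
  every deterministic stub is a THEOREM (A3, A4, B3, C2, `TwistedSplittingBound`, `SeparatorSheetMarkov`;
  A1, A2, B1, B2, C1, `SchurOfHermitianAddITau` were proved by their authors); the undecidable-here
  stubs are `SlabGapTransfer` (superconfinement-carry) and the route-shaped `VUniformDefectRarity`
  (uv-sign-erasure), whose shape stub is vacuous at `δ = 1`; `sign_lowerBound_needs_decorrelation`:
  uv-sign-erasure's displayed sign bound is false without its conditional-decorrelation input (cycle-1
  model).  Nothing killed; constants checked (C2's ⌊s/2⌋-vs-⌈s/2⌉ slip is absorbed by its factor `64`).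

## Why it resists (for the lead / planner)

1. Truth value: `S ⇐ QCD`; `¬S ⇒ ¬QCD`.  No counterexample search, small model, degenerate parameter
   (`Nf ∈ {2,3}` guard, `M₀` prover-chosen, `m → M₀⁺/∞` harmless since `R, T, Δ` come after `m`) or
   barrier can bite an implication whose consequent is the audited summit conjunct.  Barriers
   (`HoppingExpansionUniformGap/Locality`, `WilsonDeterminantSign/MassSplitting`, `UVStabilityNonUniqueness`,
   `AokiPhase`, `ImprovedActionPositivityViolation`) are mechanism-level only.
2. Vacuity would need `¬RobustYangMills` (13897, shared with HeavyThresholdYMBridge) or `¬CoerciveSea`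
   (13901) as LANDED theorems; both are closed `Prop`s about continuum/lattice `SU(3)` measures with no
   decidable instance; their junk directions were closed by restatements (rev 4 / promote-to-A); the
   sibling disprover of 13901 confirms: pin masses forced into `[−8, 0]`, hinge junk-true only WITHOUT
   the pin.
3. What a proof must supply beyond the hypotheses (each QCD-hard; (d), (e) are now theorems here):
   (a) a renormalised multiscale bound putting the sea into bounded block activities BEFORE
   `RobustYangMills` can be invoked (§4); (b) the whole mesonic sector (`pseudoRe` species = propagator
   insertions `adj D_W / det D_W`, not bounded cylinder functions; flavoured `HasLatticeMassGap`) —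
   `RobustYangMills` delivers `YMSpecies = LocalGaugeObservable` only; (c) sign transfer with a
   decorrelation input absent from both hypotheses (§2); (d) uniqueness or `m`-equicontinuity to pass from
   `W`-dependent subsequences to one `reg` for all `m` (§6); (e) a two-loop-exact, divergent coupling shift
   `β′_k − reg.β_k = (N_f/12π²) log a_k⁻² + 2Δ(b₁/b₀) log log a_k⁻² + C + o(1)` extracted from the sea (§8).

## Targets
None received (payload `targets` / `stuck_stubs` empty through cycle 2: eight cards filed, no triage
panel / PICKED line yet).  When a line is picked its stubs become the `-- Targets` section here.

## For the ideators / lead (eight cards of round 1) and the sibling disprovers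

* Sibling disprover of the hinge (`Cruxes/CoerciveSea/Disproof.lean`, landed
  `Theorems/CoerciveSea/Negative/SeilerBothSides.lean`): the pin (iii) forces the pin masses into
  `[−8, 0]` eventually (`Re det D_W > 0` for `|m+4| > 4`), and WITHOUT the pin the hinge is junk-TRUE
  (`mcrit ≡ 1`).  Read together with §5 here: the branch information a bridge prover needs
  (`m_f(k) > −1` for `IsQCDAlong`) is an UPPER bound from (iii) (now a theorem) plus a LOWER bound that
  only the dilution clause (ii) can give (doubler lines `−2, −4, −6` make every physical-branch
  crossing an "early crosser") — no lemma yet; a line that reuses `CoerciveSea`'s `reg` must prove it.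
  (The staggering symmetry `m ↔ −8 − m` that would make the lower bound hopeless is NOT available: it
  needs a bipartite lattice and the route's tori `(ℤ/(2S+1))⁴` are odd — checked in cycle 2.)
* All eight cards (average-the-dissection / condition-then-quench / degenerate-doublet-anchor;
  twisted-elliptic-splitting / superconfinement-carry / impedance-coordinates; proper-time-quarantine /
  uv-sign-erasure): stub audit in §7.  Messages: (i) every card that consumes `RobustYangMills` at `W ≡ 0`
  (superconfinement-carry, uv-sign-erasure, proper-time-quarantine) compares Wilson measures at couplings
  `β′_k` (pure-gauge profile) and `reg.β_k` (QCD profile) that are `(N_f/12π²) log a_k⁻²` apart at the same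
  `k` (§8) — "β-universality" across a DIVERGENT coupling gap at fixed spacing is the decoupling theorem
  itself, to two loops; (ii) every card that ends in OS data for `QCDField N_f` along `reg.scheme m` must
  say where uniqueness / `m`-equicontinuity (§6 (U)/(E)) comes from; (iii) condition-then-quench B3 and
  uv-sign-erasure both need a per-block defect RATE (`half_defect_mass_zero_sign`,
  `sign_lowerBound_needs_decorrelation`), which `CoerciveSea` (ii) does not state at any rate in `k`;
  (iv) twisted-elliptic-splitting: `|F_τ| = ∏_j |q_j|/√(q_j²+τ²)` has `log|F_τ| ≍ −½τ² Tr Q⁻²`, extensive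
  — its KP activities are `O(1)` per cell before a cell-wise renormalisation; smallness again = rarity of
  `|q_j| ≲ τ` (a rate).
* Card degenerate-doublet-anchor: consistent with `signedWeight_ne_boltzmann` — for `N_f = 2` the
  signed weight is negative only through a crossing inside the splitting window; the anchor measure
  `det((D+m̄)²−δ²)` is positive off that event (card A2), so §4's sign obstruction localises to the
  window exactly as the card claims; its stubs A3/A4 are theorems (§7).

## Dead ends (one line each)
* junk-true conclusion (vacuum `T`, `z ≡ 0`): excluded by `IsNontrivial glue` / `pseudoRe` clauses.
* junk in `P`, `wt` of `CoerciveSea` (non-integrable / non-measurable integrands): all integrands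
  continuous on a compact product of `SU(3)`'s with Borel = product σ-algebra; honest probabilities.
* `RobustYangMills` junk-false via LIP with a `β`-shift `W′`: the block sup-norm charges `(ℓ₀/a)⁴` per
  unit shift, response stays `O(δ)`; via bounded indicator activities: excluded or undecidable by (h2) RP.
* `RobustYangMills` junk-true via an EMPTY admissible cone (odd-torus RP unprovable in the tree): can
  only empty the cone, i.e. make 13897 vacuous-true and the bridge's hypothesis worthless, never false.
* junk-false `QCD` via `HasLatticeMassGap` (signed ratios, all volumes `S ≥ L_k`, torus periodicity):
  `L_k` is witness data, `C` is per pair, `n ≤ S`; no handle (cycle 2).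
* `m ↔ −8−m` staggering to void the branch lemma: unavailable on odd tori (cycle 2).
* refuting C2 `UVSeparatorActivityBound` through its ⌊s/2⌋/⌈s/2⌉ slip: the factor `64` absorbs it; a
  numerical refutation would need an exact `180 × 180` determinant in Lean — not pursued (cycle 2).
* literature in cycle 2: searchd rc 75, arXiv/OpenAlex/S2 429 after three rows — `search-degraded`; held
  and read: Athenodorou–Finkenrath–Knechtli–Korzec–Leder–Marinković–Sommer 2019 (arXiv:1809.03383) §3.
-/

noncomputable section

namespace Summit.QuantumFields.QCD.Cruxes.SeaFactorisationBridge.Disproof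

open Filter Topology MeasureTheory Finset
open Literature.MathematicalPhysics.QuantumFieldTheory Literature.MathematicalPhysics.QuantumLattice
open Summit.QuantumFields.QCD.Theses.NestedDissectionSea
open Summit.QuantumFields.QCD.Theorems.GluonicCompletion.Negative (qcdOf_iff_threshold)

/-! ## §1 The kill profile (logical form of the crux) -/

/-- The bare conclusion of the bridge: the threshold form of `QCDOf 2 ∧ QCDOf 3` (verbatim). -/
def Conclusion : Prop :=
  ∀ Nf : ℕ, Nf = 2 ∨ Nf = 3 → ∃ M₀ : ℝ, 0 ≤ M₀ ∧ ∃ reg : QCDRegularisation Nf, reg.HasMassScaling ∧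
    ∀ m : Fin Nf → ℝ, (∀ f, M₀ < m f) →
      ∃ (z shift : QCDField Nf → ℕ → ℝ) (T : OSData (QCDField Nf) 4),
        IsQCDAlong (reg.scheme m z shift) T ∧ T.IsNontrivial QCDField.glue ∧ T.IsNonGaussian QCDField.glue ∧
          (∀ f g : Fin Nf, f ≠ g → T.IsNontrivial (QCDField.pseudoRe f g)) ∧
            ∃ Δ > 0, T.HasMassGap Δ ∧ (reg.scheme m z shift).HasLatticeMassGap Δ

/-- Readback: the crux is literally `RobustYangMills → CoerciveSea → Conclusion`. -/
theorem bridge_iff_conclusion :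
    SeaFactorisationBridge ↔ (RobustYangMills → CoerciveSea → Conclusion) := Iff.rfl

/-- The bare conclusion IS the sub-problem statement `QCD` (threshold reading, audit g7). -/
theorem conclusion_iff_qcd : Conclusion ↔ QCD := by
  constructor
  · intro h
    exact ⟨(qcdOf_iff_threshold 2).2 (h 2 (Or.inl rfl)), (qcdOf_iff_threshold 3).2 (h 3 (Or.inr rfl))⟩
  · rintro ⟨h2, h3⟩ Nf (rfl | rfl)
    · exact (qcdOf_iff_threshold 2).1 h2
    · exact (qcdOf_iff_threshold 3).1 h3

/-- The crux is EXACTLY "the two other cruxes imply the sub-problem". -/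
theorem bridge_iff : SeaFactorisationBridge ↔ (RobustYangMills → CoerciveSea → QCD) := by
  rw [bridge_iff_conclusion]
  exact ⟨fun h hY hS => conclusion_iff_qcd.1 (h hY hS), fun h hY hS => conclusion_iff_qcd.2 (h hY hS)⟩

/-- **Kill profile.** A disproof of the bridge is a proof of robust `SU(3)` Yang–Mills AND of the
coercive sea AND a DISPROOF OF THE SUMMIT CONJUNCT `QCD` as formalised — nothing less. -/
theorem not_bridge_iff : ¬ SeaFactorisationBridge ↔ (RobustYangMills ∧ CoerciveSea ∧ ¬ QCD) := by
  rw [bridge_iff]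
  constructor
  · intro h
    by_contra h'
    exact h fun hY hS => by_contra fun hQ => h' ⟨hY, hS, hQ⟩
  · rintro ⟨hY, hS, hQ⟩ h
    exact hQ (h hY hS)

/-- Vacuity direction 1: if the Yang–Mills crux falls, the bridge closes trivially. -/
theorem bridge_of_not_robustYangMills (h : ¬ RobustYangMills) : SeaFactorisationBridge :=
  fun hY => absurd hY h

/-- Vacuity direction 2: if the hinge falls, the bridge closes trivially. -/
theorem bridge_of_not_coerciveSea (h : ¬ CoerciveSea) : SeaFactorisationBridge :=
  fun _ hS => absurd hS h

/-- The summit conjunct alone proves the bridge (hypotheses unused). -/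
theorem bridge_of_qcd (h : QCD) : SeaFactorisationBridge :=
  bridge_iff.2 fun _ _ => h

/-! ## §2 Composition gap: marginal dilution of sign defects does not license sign transfer
(finite models, definition-free) -/

/-- Sign of a defect pattern with at most one defect cell: `none` = all window cells clean (`+1`),
`some i` = exactly one sign defect, sitting in cell `i` (`−1`). -/
def oneDefectSign {n : ℕ} : Option (Fin n) → ℝ
  | none => 1
  | some _ => -1

/-- **Dilute marginals, zero sign average.** For every number `n ≥ 1` of window cells there is a
probability law `p` on defect patterns (here: patterns with at most one defect) whose ONE-CELL
MARGINALS are as small as `1/(2n)` — so every per-cell / per-scale dilution bound of the shape of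
`CoerciveSea` (ii) / `NegativeCellsDilute` (a) holds with room to spare as `n → ∞` — while the
average sign is EXACTLY `0`: `p(no defect) = ½`, `p(defect at i) = 1/(2n)`.  Read with `p` = the
phase-quenched law of the cell-sign field and sign = `∏` cell signs `= sign Re det D_W` (the route's
exact factorisation), this is a phase-quenched sea obeying every marginal dilution bound whose
SIGNED partition function `⟨sign⟩₊ · Z₊` vanishes, so that every signed expectation
(`qcdTorusExpect`, `qcdLatticeSchwinger`: junk `0/0`) is meaningless.  Hence step (3) of the bridge
("sign transfer by a Kotecký–Preiss expansion in the window-dilute cells of `CoerciveSea` (ii)")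
needs a DECORRELATION input on the defect field under the phase-quenched measure that neither
hypothesis states: `CoerciveSea` bounds one-cell marginals only, and the clustering clause of
`RobustYangMills` speaks of measures `e^{−β′S_W − W}` with `W` sup-small, which the phase-quenched
sea is not (§4).  [finite model; the cells are abstract] -/
theorem dilute_marginals_zero_sign (n : ℕ) (hn : 0 < n) :
    ∃ p : Option (Fin n) → ℝ, (∀ c, 0 ≤ p c) ∧ ∑ c, p c = 1 ∧
      (∀ i : Fin n, ∑ c, (if c = some i then p c else 0) = 1 / (2 * n)) ∧
      ∑ c, p c * oneDefectSign c = 0 := by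
  have hn' : (n : ℝ) ≠ 0 := by exact_mod_cast hn.ne'
  refine ⟨fun c => Option.elim c (1 / 2) fun _ => 1 / (2 * n), ?_, ?_, ?_, ?_⟩
  · intro c; cases c <;> simp only [Option.elim] <;> positivity
  · rw [Fintype.sum_option]
    simp only [Option.elim, sum_const, card_univ, Fintype.card_fin, nsmul_eq_mul]
    field_simp; ring
  · intro i
    rw [Finset.sum_ite_eq' univ (some i)]
    simp
  · rw [Fintype.sum_option]
    simp only [Option.elim, oneDefectSign, sum_const, card_univ, Fintype.card_fin, nsmul_eq_mul]
    field_simp; ring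

/-- **Tightness of the `p < ½` hypothesis of card condition-then-quench (B2 `condQuench_lower`:
signed block mass `≥ (1 − 2p) ×` quenched block mass when the conditional defect mass is `≤ p`).**  At
conditional defect mass EXACTLY `½` the signed mass can vanish while every one-cell marginal is only
`1/(2n)`: same witness as `dilute_marginals_zero_sign`, with the total defect probability made
explicit.  So B2 cannot be fed by marginal dilution of the cells inside a block (their number
`(ℓ₀/(a_k b₀))⁴ → ∞`); it needs the conditional probability of "at least one defect in the block",
i.e. a RATE `δ_j ≪ (a_k b₀ 2^j/ℓ₀)⁴` per cell or a joint bound — exactly the input the card then bets on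
(zero-mode action floor).  [finite model] -/
theorem half_defect_mass_zero_sign (n : ℕ) (hn : 0 < n) :
    ∃ p : Option (Fin n) → ℝ, (∀ c, 0 ≤ p c) ∧ ∑ c, p c = 1 ∧
      (∀ i : Fin n, p (some i) = 1 / (2 * n)) ∧ ∑ i : Fin n, p (some i) = 1 / 2 ∧
      ∑ c, p c * oneDefectSign c = 0 := by
  have hn' : (n : ℝ) ≠ 0 := by exact_mod_cast hn.ne'
  refine ⟨fun c => Option.elim c (1 / 2) fun _ => 1 / (2 * n), ?_, ?_, fun i => rfl, ?_, ?_⟩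
  · intro c; cases c <;> simp only [Option.elim] <;> positivity
  · rw [Fintype.sum_option]
    simp only [Option.elim, sum_const, card_univ, Fintype.card_fin, nsmul_eq_mul]
    field_simp; ring
  · simp only [Option.elim, sum_const, card_univ, Fintype.card_fin, nsmul_eq_mul]
    field_simp
  · rw [Fintype.sum_option]
    simp only [Option.elim, oneDefectSign, sum_const, card_univ, Fintype.card_fin, nsmul_eq_mul]
    field_simp; ring

/-- **Independent dilute defects: the sign average dies exponentially in the number of cells.**
With `n` window cells flipping sign independently with probability `δ` each (product law), the
average sign is `(1 − 2δ)ⁿ` — exponentially small in the volume (number of cells `≍ (side/ℓ)⁴`) for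
every fixed dilution `δ > 0`.  So even in the best (independent) case the signed functional is a
ratio of two quantities that are `e^{−c·volume}`-small relative to the phase-quenched ones: sign
transfer can only ever be an EXTENSIVE statement about `log⟨sign⟩₊` (a convergent cluster expansion,
uniform in the volume since `HasLatticeMassGap` quantifies over all tori `S ≥ L_k`), never a bound
on `⟨sign⟩₊` from below.  [finite model] -/
theorem independent_defects_sign_average (n : ℕ) (δ : ℝ) :
    ∑ x : Fin n → Bool, ∏ i, ((if x i then δ else 1 - δ) * (if x i then (-1 : ℝ) else 1)) =
      (1 - 2 * δ) ^ n := by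
  classical
  have key := Finset.prod_univ_sum (fun _ : Fin n => (univ : Finset Bool))
    (fun _ b => (if b then δ else 1 - δ) * (if b then (-1 : ℝ) else 1))
  rw [Fintype.piFinset_univ] at key
  rw [← key]
  simp
  ring

/-! ## §3 The first hypothesis contains `SU(3)` Yang–Mills existence AND mass gap (certified reduction,
modulo lattice reflection positivity on odd tori) -/

section YM

local notation "𝔾" => Matrix.specialUnitaryGroup (Fin 3) ℂ

/-- Reflection positivity of Wilson's `SU(3)` measure on the ODD tori `(ℤ/(2S+1))⁴` for the tree's link
reflection `GaugeConfig.timeReflect` (hyperplane between slices `0|1`, hence THROUGH slice `S+1`), in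
the `QuasiLocalGaugePerturbation.IsReflectionPositive` format at `W = 0`, for `β ≥ 0`.  The tree's
named fact `wilsonExpectation_reflectionPositive` covers EVEN sides only; `RobustYangMills` (h2) asks
RP on odd sides, so even `W ≡ 0` is admissible only through this odd-side companion (site + link
reflection positivity of the Wilson action, Osterwalder–Seiler 1978 §2).  A HYPOTHESIS here, never
asserted. -/
def OddTorusWilsonRP : Prop :=
  ∀ (S b : ℕ) (β : ℝ), 0 ≤ β →
    (0 : QuasiLocalGaugePerturbation 4 (2 * S + 1) 𝔾 b).IsReflectionPositive (fundamentalRep (Fin 3)) β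

/-- The body of the summit conjunct `YangMills` at `G = SU(3)`, fundamental lattice representation
(ambient Borel structure of `SU(3) ⊆ M₃(ℂ)`; `YangMills` itself re-declares `borel G`). -/
def YangMillsBodySU3 : Prop :=
  let r₃ : LatticeRep 𝔾 := ⟨3, fundamentalRep (Fin 3), continuous_fundamentalRep _,
    fundamentalRep_injective _, fundamentalRep_mem_unitaryGroup⟩
  ∃ (sch : SpeciesScheme (YMSpecies 𝔾)) (T : OSData (YMSpecies 𝔾) 4),
    IsYangMillsFor r₃ sch T ∧ T.IsNontrivial r₃.curvature ∧ T.IsNonGaussian r₃.curvature ∧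
      ∃ Δ > 0, T.HasMassGap Δ ∧ HasLatticeMassGap r₃ sch Δ

/-- `b₀(N_f = 0) > 0`. -/
theorem betaCoeff₀_zero_pos : 0 < betaCoeff₀ 0 := by
  unfold betaCoeff₀; norm_num; positivity

/-- `b₁(N_f = 0) ≥ 0`. -/
theorem betaCoeff₁_zero_nonneg : 0 ≤ betaCoeff₁ 0 := by
  unfold betaCoeff₁; norm_num; positivity

/-- Along the canonical spacings `a_k = 1/(k+1)` the pure-gauge two-loop profile `afBeta 0 1 a_k` is
eventually non-negative (both logarithms are `≥ 0` once `(k+1)² ≥ e`). -/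
theorem afBeta_zero_canonical_nonneg : ∀ᶠ k : ℕ in atTop, 0 ≤ afBeta 0 1 (((k : ℝ) + 1)⁻¹) := by
  filter_upwards [eventually_ge_atTop 1] with k hk
  have hk' : (1 : ℝ) ≤ k := by exact_mod_cast hk
  have hx : (1 : ℝ) / ((((k : ℝ) + 1)⁻¹) ^ 2 * 1 ^ 2) = ((k : ℝ) + 1) ^ 2 := by
    field_simp
  have h4 : Real.exp 1 ≤ ((k : ℝ) + 1) ^ 2 := by
    have := Real.exp_one_lt_d9
    nlinarith
  have hlog : 1 ≤ Real.log (((k : ℝ) + 1) ^ 2) := by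
    rw [Real.le_log_iff_exp_le (by positivity)]; exact h4
  have hlog0 : 0 ≤ Real.log (((k : ℝ) + 1) ^ 2) := zero_le_one.trans hlog
  have hloglog : 0 ≤ Real.log (Real.log (((k : ℝ) + 1) ^ 2)) := Real.log_nonneg hlog
  have hb0 := betaCoeff₀_zero_pos
  have hb1 := betaCoeff₁_zero_nonneg
  unfold afBeta
  rw [hx]
  have : 0 ≤ betaCoeff₁ 0 / betaCoeff₀ 0 := div_nonneg hb1 hb0.le
  positivity

/-- **`RobustYangMills` ⊇ Yang–Mills existence and mass gap for `SU(3)`** (modulo `OddTorusWilsonRP`):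
instantiate the crux at `W ≡ 0` along the canonical scaling data (`a_k = 1/(k+1)`, `L_k = (k+1)²`,
`β′_k = afBeta 0 1 a_k`, `Λ′ = ℓ₀ = 1`); admissibility of `0` is symmetry (trivial), `NormLE` (trivial),
range control (vacuous) and RP (the hypothesis, at `β′_k ≥ 0` eventually); the crux returns a
subsequence `φ`, renormalisations `(c, m)`, OS data `T` and `Δ > 0`, and the summit conjunct's body at
`G = SU(3)` follows along the REINDEXED scheme `k ↦ φ k` (`perturbedLatticeSchwinger_zero`,
`connectedCorr_zero`).  Consequence for the bridge: its first hypothesis is at least Clay-hard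
(cannot be junk-true unless the audited `YangMills` body is junk-provable at `SU(3)`), so the
vacuity direction `¬RobustYangMills → SeaFactorisationBridge` is the only cheap way the crux could
ever close, and it would close the ROUTE, not the problem. -/
theorem yangMillsSU3_of_robustYangMills (hRP : OddTorusWilsonRP) (hY : RobustYangMills) :
    YangMillsBodySU3 := by
  obtain ⟨η₀, hη₀, κ, hκ, h⟩ := hY
  let Z := SpeciesScheme.zero (YMSpecies 𝔾)
  have hconst : Tendsto (fun k => afBeta 0 1 (Z.a k) - afBeta 0 1 (Z.a k)) atTop (𝓝 0) := by simp
  have h1 := h Z.a Z.L Z.a_pos Z.tendsto_a Z.tendsto_L (fun k => afBeta 0 1 (Z.a k)) 1 one_pos hconst 1 one_pos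
    (fun k S => (0 : QuasiLocalGaugePerturbation 4 (2 * S + 1) 𝔾 ⌊(1 : ℝ) / Z.a k⌋₊)) ?adm
  case adm =>
    filter_upwards [afBeta_zero_canonical_nonneg] with k hk S _hS
    refine ⟨fun v U => by simp, fun U => by simp, fun π U => by simp, hRP S _ _ hk, ?_, ?_⟩
    · exact QuasiLocalGaugePerturbation.normLE_zero
        (div_nonneg hη₀.le (zero_le_one.trans (le_max_left _ _)))
    · intro X _ hU
      obtain ⟨U, hU⟩ := hU
      simp at hU
  obtain ⟨φ, hφ, c, m, T, Δ, hΔ, hconv, hNT, hNG, hgap, hlgap, -⟩ := h1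
  clear h
  let sch : SpeciesScheme (YMSpecies 𝔾) :=
    { a := fun j => Z.a (φ j)
      a_pos := fun j => Z.a_pos (φ j)
      tendsto_a := Z.tendsto_a.comp hφ.tendsto_atTop
      β := fun j => afBeta 0 1 (Z.a (φ j))
      L := fun j => Z.L (φ j)
      tendsto_L := Z.tendsto_L.comp hφ.tendsto_atTop
      c := fun s j => c s (φ j)
      m := fun s j => m s (φ j) }
  refine ⟨sch, T, ?_, hNT, hNG, Δ, hΔ, hgap, ?_⟩
  · intro n hn σ f F hF hoff
    refine (hconv n hn σ f F hF hoff).congr fun j => ?_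
    simp only [perturbedLatticeSchwinger, SpeciesScheme.side, QuasiLocalGaugePerturbation.expectation_zero,
      wilsonExpectation, latticeSchwinger]
    rfl
  · intro A B
    obtain ⟨C, hC⟩ := hlgap A B
    refine ⟨C, ?_⟩
    filter_upwards [hφ.tendsto_atTop.eventually hC] with j hj S hS n hn
    have := hj S hS n hn
    rwa [QuasiLocalGaugePerturbation.connectedCorr_zero] at this

end YM

/-! ## §4 The admissible cone of `RobustYangMills` is sup-small; the sea is not in it
(re-creation, with credit, of refuter rattack-13902's `D1SeaObstruction.lean` §2, whose file lives on
the gate box and is not readable from the hub) -/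

section Cone

variable {S b : ℕ} [NeZero S]

local notation "𝔾" => Matrix.specialUnitaryGroup (Fin 3) ℂ

/-- An activity on the empty polymer depends on no link: it is a constant. -/
theorem act_empty_const (W : QuasiLocalGaugePerturbation 4 S 𝔾 b) (U V : GaugeConfig 4 S 𝔾) :
    W.act ∅ U = W.act ∅ V :=
  W.dependsOn ∅ (fun e he => by simp at he)

/-- **Double counting.** Summing the weighted sums over all block corners counts every non-empty
polymer at least once: `∑_{X ≠ ∅} ‖W_X‖_∞ ≤ ∑_y ∑_{X ∋ y} ‖W_X‖_∞ e^{κ|X|}` (`κ ≥ 0`). -/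
theorem sum_supNorm_le_sum_weightedSum (W : QuasiLocalGaugePerturbation 4 S 𝔾 b) {κ : ℝ}
    (hκ : 0 ≤ κ) :
    ∑ X ∈ (polymers b).filter (fun X => X.Nonempty), W.supNorm X ≤
      ∑ y ∈ blockCorners (d := 4) (L := S) b, W.weightedSum κ y := by
  classical
  -- rewrite the right-hand side as a sum over polymers of (number of corners in X) • term
  have hR : ∑ y ∈ blockCorners (d := 4) (L := S) b, W.weightedSum κ y =
      ∑ X ∈ polymers b, ∑ y ∈ blockCorners (d := 4) (L := S) b,
        (if y ∈ X then W.supNorm X * Real.exp (κ * X.card) else 0) := by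
    simp only [QuasiLocalGaugePerturbation.weightedSum, polymersThrough, Finset.sum_filter]
    exact Finset.sum_comm
  rw [hR, Finset.sum_filter]
  refine Finset.sum_le_sum fun X hX => ?_
  split_ifs with hne
  · obtain ⟨y, hy⟩ := hne
    have hyC : y ∈ blockCorners (d := 4) (L := S) b := mem_polymers_iff.1 hX hy
    have h1 : W.supNorm X ≤ W.supNorm X * Real.exp (κ * X.card) := by
      have : (1 : ℝ) ≤ Real.exp (κ * X.card) := Real.one_le_exp (by positivity)
      nlinarith [W.supNorm_nonneg X]
    refine h1.trans ?_
    rw [← Finset.sum_filter]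
    exact Finset.single_le_sum (f := fun _ => W.supNorm X * Real.exp (κ * X.card))
      (fun _ _ => mul_nonneg (W.supNorm_nonneg X) (Real.exp_pos _).le) (Finset.mem_filter.2 ⟨hyC, hy⟩)
  · exact Finset.sum_nonneg fun _ _ => by
      split_ifs
      · exact mul_nonneg (W.supNorm_nonneg X) (Real.exp_pos _).le
      · exact le_rfl

/-- **The cone is sup-small** (oscillation bound): in the admissible cone `NormLE κ η` (`κ ≥ 0`) of
`RobustYangMills` the TOTAL perturbation oscillates by at most `2η` per block over ALL pairs of
configurations: `|W(U) − W(V)| ≤ 2η · #blocks` — i.e. `O(η)` per physical block `ℓ₀⁴`, hence `→ 0`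
PER SITE as `a_k → 0`.  The sea's effective action `−N_f Σ log|det S_Σ|` / `−Σ_f log|det D_W|`
oscillates by `O(1)` per SITE (and is unbounded at resonant cells), so it is outside the cone by a
factor `(ℓ₀/a_k)⁴ → ∞` before any renormalisation: `RobustYangMills` can only be met AFTER the sea
has been renormalised into bounded block activities — the whole content of the informal step (1). -/
theorem abs_total_sub_total_le (W : QuasiLocalGaugePerturbation 4 S 𝔾 b) {κ η : ℝ} (hκ : 0 ≤ κ)
    (h : W.NormLE κ η) (U V : GaugeConfig 4 S 𝔾) :
    |W.total U - W.total V| ≤ 2 * η * (blockCorners (d := 4) (L := S) b).card := by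
  classical
  have hsplit : W.total U - W.total V =
      ∑ X ∈ (polymers b).filter (fun X => X.Nonempty), (W.act X U - W.act X V) := by
    rw [QuasiLocalGaugePerturbation.total, QuasiLocalGaugePerturbation.total, ← Finset.sum_sub_distrib,
      Finset.sum_filter]
    refine Finset.sum_congr rfl fun X _ => ?_
    split_ifs with hne
    · rfl
    · rw [Finset.not_nonempty_iff_eq_empty.1 hne, act_empty_const W U V, sub_self]
  rw [hsplit]
  calc |∑ X ∈ (polymers b).filter (fun X => X.Nonempty), (W.act X U - W.act X V)|
      ≤ ∑ X ∈ (polymers b).filter (fun X => X.Nonempty), |W.act X U - W.act X V| :=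
        Finset.abs_sum_le_sum_abs _ _
    _ ≤ ∑ X ∈ (polymers b).filter (fun X => X.Nonempty), 2 * W.supNorm X := by
        refine Finset.sum_le_sum fun X _ => ?_
        calc |W.act X U - W.act X V| ≤ |W.act X U| + |W.act X V| := abs_sub _ _
          _ ≤ W.supNorm X + W.supNorm X := add_le_add (W.abs_act_le_supNorm X U) (W.abs_act_le_supNorm X V)
          _ = 2 * W.supNorm X := by ring
    _ = 2 * ∑ X ∈ (polymers b).filter (fun X => X.Nonempty), W.supNorm X := by rw [Finset.mul_sum]
    _ ≤ 2 * ∑ y ∈ blockCorners (d := 4) (L := S) b, W.weightedSum κ y := by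
        have := sum_supNorm_le_sum_weightedSum W hκ
        linarith
    _ ≤ 2 * ∑ _y ∈ blockCorners (d := 4) (L := S) b, η := by
        have := Finset.sum_le_sum fun y (hy : y ∈ blockCorners (d := 4) (L := S) b) => h y hy
        linarith
    _ = 2 * η * (blockCorners (d := 4) (L := S) b).card := by
        rw [Finset.sum_const, nsmul_eq_mul]; ring

/-- **Positivity of every perturbed Boltzmann weight**: `e^{−β′S_W(U) − W(U)} > 0` for EVERY
quasi-local perturbation `W` (admissible or not) and every coupling `β′`. -/
theorem perturbedDensity_pos (W : QuasiLocalGaugePerturbation 4 S 𝔾 b) (β' : ℝ) (U : GaugeConfig 4 S 𝔾) :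
    0 < Real.exp (-β' * wilsonAction (fundamentalRep (Fin 3)) U - W.total U) :=
  Real.exp_pos _

/-- **The signed sea is never a `RobustYangMills` measure.** If the signed fermionic weight
`Re ∏_f det D_W(U, m_f)` is negative at ONE configuration (the route's own regime: the sign problem is
its raison d'être; `N_f = 2` with split masses included), then for NO perturbation `W`, NO coupling
`β′` and NO constant `c ≥ 0` is it the Boltzmann weight `c · e^{−β′S_W − W}`: the hypothesis
`RobustYangMills` cannot be INSTANTIATED on the signed QCD gauge marginal — step (3) (sign transfer)
is unavoidable and lies outside everything `RobustYangMills` delivers. -/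
theorem signedWeight_ne_boltzmann {Nf : ℕ} (mq : Fin Nf → ℝ)
    (hneg : ∃ U₀ : GaugeConfig 4 S 𝔾,
      (∏ f, fermionDet (wilsonDirac (fundamentalRep (Fin 3)) U₀ (mq f) 1)).re < 0)
    (W : QuasiLocalGaugePerturbation 4 S 𝔾 b) (β' c : ℝ) (hc : 0 ≤ c) :
    (fun U : GaugeConfig 4 S 𝔾 => (∏ f, fermionDet (wilsonDirac (fundamentalRep (Fin 3)) U (mq f) 1)).re) ≠
      fun U => c * Real.exp (-β' * wilsonAction (fundamentalRep (Fin 3)) U - W.total U) := by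
  obtain ⟨U₀, hU₀⟩ := hneg
  intro h
  have h0 := congrFun h U₀
  have : 0 ≤ c * Real.exp (-β' * wilsonAction (fundamentalRep (Fin 3)) U₀ - W.total U₀) :=
    mul_nonneg hc (Real.exp_pos _).le
  linarith

/-- **Nor is the phase-quenched sea** (the weight `wt` of `CoerciveSea`): if ONE configuration has an
exact zero mode at one of the bare masses (a real-eigenvalue crossing AT `m_f(k)`; in the route's
regime `m_crit(k) < 0` such configurations exist by the intermediate value theorem along any path from
a negative-determinant field to `U ≡ 1`), then `∏_f ‖det D_W(U, m_f)‖` is not `c · e^{−β′S_W − W}` for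
any `W`, `β′` and `c ≠ 0`; and `c = 0` is excluded as soon as one determinant is non-zero.  So even
the positive phase-quenched measure is outside the cone, for the soft reason (zeros) before the
quantitative one (`abs_total_sub_total_le`). -/
theorem quenchedWeight_ne_boltzmann {Nf : ℕ} (mq : Fin Nf → ℝ)
    (hzero : ∃ (U₀ : GaugeConfig 4 S 𝔾) (f : Fin Nf),
      fermionDet (wilsonDirac (fundamentalRep (Fin 3)) U₀ (mq f) 1) = 0)
    (hpos : ∃ U₁ : GaugeConfig 4 S 𝔾, ∀ f,
      fermionDet (wilsonDirac (fundamentalRep (Fin 3)) U₁ (mq f) 1) ≠ 0)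
    (W : QuasiLocalGaugePerturbation 4 S 𝔾 b) (β' c : ℝ) :
    (fun U : GaugeConfig 4 S 𝔾 => ∏ f, ‖fermionDet (wilsonDirac (fundamentalRep (Fin 3)) U (mq f) 1)‖) ≠
      fun U => c * Real.exp (-β' * wilsonAction (fundamentalRep (Fin 3)) U - W.total U) := by
  obtain ⟨U₀, f₀, hU₀⟩ := hzero
  obtain ⟨U₁, hU₁⟩ := hpos
  intro h
  have h0 := congrFun h U₀
  have h1 := congrFun h U₁
  have hz : ∏ f, ‖fermionDet (wilsonDirac (fundamentalRep (Fin 3)) U₀ (mq f) 1)‖ = 0 :=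
    Finset.prod_eq_zero (Finset.mem_univ f₀) (by rw [hU₀, norm_zero])
  rw [hz] at h0
  have hc : c = 0 := by
    have hexp := Real.exp_pos (-β' * wilsonAction (fundamentalRep (Fin 3)) U₀ - W.total U₀)
    have := mul_eq_zero.1 h0.symm
    rcases this with hc | hexp0
    · exact hc
    · exact absurd hexp0 hexp.ne'
  rw [hc, zero_mul] at h1
  have : 0 < ∏ f, ‖fermionDet (wilsonDirac (fundamentalRep (Fin 3)) U₁ (mq f) 1)‖ :=
    Finset.prod_pos fun f _ => norm_pos_iff.2 (hU₁ f)
  linarith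

/-- **The zero locus is never empty at the massless point.** On every torus the massless `r = 1`
Wilson operator in the TRIVIAL gauge field `U ≡ 1` kills the constant colour-spinor (landed
`TiltedFlatnessNegative.det_wilsonDirac_massless_eq_zero_iff`: `det D_W(U;0,1) = 0` iff `U` has a
parallel colour field), so `det D_W(1; 0, 1) = 0`. -/
theorem det_wilsonDirac_trivial_massless_eq_zero :
    (wilsonDirac (fundamentalRep (Fin 3)) (fun _ => (1 : 𝔾)) 0 1 :
      Matrix (Literature.Probability.LatticeModels.TorusSite 4 S × Fin 3 × Fin 4)
        (Literature.Probability.LatticeModels.TorusSite 4 S × Fin 3 × Fin 4) ℂ).det = 0 := by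
  rw [Summit.QuantumFields.QCD.Theorems.TiltedFlatnessNegative.det_wilsonDirac_massless_eq_zero_iff
    (fundamentalRep (Fin 3)) fundamentalRep_mem_unitaryGroup]
  refine ⟨fun _ => 1, ?_, ?_⟩
  · intro h
    simpa using congrFun h ((0 : Literature.Probability.LatticeModels.TorusSite 4 S), (0 : Fin 3), (0 : Fin 4))
  · intro x μ a α
    simp [Matrix.one_apply]

/-- Hence the phase-quenched weight of any mass tuple with a MASSLESS flavour vanishes at `U ≡ 1`
(concrete instance of the hypothesis `hzero` of `quenchedWeight_ne_boltzmann`; the physical bare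
masses `m_crit(k) + a_k m_f/Z_m(k)` are of course not `0`, where the zero locus is the codimension-one
set of fields with a real-mode crossing at the bare mass — non-empty in the route's regime by its own
data, but not certified here). -/
theorem quenchedWeight_trivial_eq_zero_of_massless {Nf : ℕ} (mq : Fin Nf → ℝ) (f₀ : Fin Nf)
    (hf : mq f₀ = 0) :
    ∏ f, ‖fermionDet (wilsonDirac (fundamentalRep (Fin 3)) (fun _ => (1 : 𝔾)) (mq f) 1 :
      Matrix (Literature.Probability.LatticeModels.TorusSite 4 S × Fin 3 × Fin 4)
        (Literature.Probability.LatticeModels.TorusSite 4 S × Fin 3 × Fin 4) ℂ)‖ = 0 :=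
  Finset.prod_eq_zero (Finset.mem_univ f₀)
    (by rw [norm_eq_zero, hf]; exact det_wilsonDirac_trivial_massless_eq_zero)

end Cone

/-! ## §5 The regularisation prefix certified by `CoerciveSea` does not make its `reg` usable in the
conclusion (alignment of `∃ reg`) -/

/-- A regularisation with the prefix properties `CoerciveSea` certifies of its witness
(`HasMassScaling`, asymptotic scaling of `reg.scheme 0 0 0`) for which the bridge's conclusion body
fails for EVERY mass tuple and EVERY `(z, shift, T)`: `m_crit ≡ −5` puts all bare masses off the
physical branch `m_f(k) > −1` demanded by `IsQCDAlong`.  So (a) the strengthening of the conclusion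
to "∀ reg with the prefix" is FALSE, the `∃ reg` is load-bearing; (b) a prover handed `CoerciveSea`'s
`reg` can reuse it in the conclusion only after extracting BRANCH information (`m_crit(k) > −1 −
a_k m/Z_m(k)` eventually) from clauses (ii)–(iii) — no such lemma exists; the one-sided pin (iii)
bounds `m_crit` above (no negative determinants at positive bare mass) but not below. -/
theorem prefix_reg_offBranch (Nf : ℕ) [NeZero Nf] :
    ∃ reg : QCDRegularisation Nf, reg.HasMassScaling ∧ (reg.scheme 0 0 0).HasAsymptoticScaling ∧
      ∀ (m : Fin Nf → ℝ) (z shift : QCDField Nf → ℕ → ℝ) (T : OSData (QCDField Nf) 4),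
        ¬ IsQCDAlong (reg.scheme m z shift) T := by
  -- witness: the canonical a.f. regularisation with `m_crit(k) := −5 − k · a_k / Z_m(k)`, so that the
  -- bare mass of flavour `f` is `−5 + (a_k/Z_m(k)) (m_f − k) ≤ −5` as soon as `k ≥ m_f`
  let R := QCDRegularisation.canonicalAF Nf
  refine ⟨{ R with mcrit := fun k => -5 - k * (R.a k / R.Zm k) }, ?_, ?_, ?_⟩
  · exact QCDRegularisation.canonicalAF_hasMassScaling
  · exact ⟨1, one_pos, tendsto_const_nhds.congr' (Eventually.of_forall fun k => (sub_self _).symm)⟩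
  · intro m z shift T hQ
    obtain ⟨-, hbranch, -⟩ := hQ
    have h0 := hbranch 0
    have hk := tendsto_natCast_atTop_atTop (R := ℝ) |>.eventually_ge_atTop (m 0)
    obtain ⟨k, hk1, hk2⟩ := (h0.and hk).exists
    have hpos : 0 < R.a k / R.Zm k := div_pos (R.a_pos k) (R.Zm_pos k)
    have hmq : (({ R with mcrit := fun k => -5 - k * (R.a k / R.Zm k) } : QCDRegularisation Nf).scheme
        m z shift).mq 0 k = -5 + (R.a k / R.Zm k) * (m 0 - k) := by
      simp only [QCDRegularisation.scheme_mq]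
      show -5 - k * (R.a k / R.Zm k) + R.a k * m 0 / R.Zm k = _
      ring
    rw [hmq] at hk1
    nlinarith [mul_nonpos_of_nonneg_of_nonpos hpos.le (sub_nonpos.2 hk2)]

/-! ## §6 `∀ W ∃ φ` (the shape of `RobustYangMills`) versus `∃ reg ∀ m` (the shape of the conclusion):
per-parameter subsequences do not assemble into one scheme (cycle 2; definition-free)

`RobustYangMills` concludes `∀ W admissible, ∃ φ StrictMono, ∃ (c, m, T, Δ), Tendsto (S_W ∘ φ) (𝓝 T.schwinger …)`
— a `W`-dependent SUBSEQUENCE and a possibly `φ`-dependent limit `T`.  The bridge's conclusion is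
`∃ M₀ ∃ reg, ∀ m > M₀, ∃ (z, shift, T), IsQCDAlong (reg.scheme m z shift) T`, and `IsQCDAlong` is
FULL-sequence convergence along `reg`'s own spacings, the same `reg` for every real mass tuple `m` (each
`m` feeds a different effective perturbation `W_m` to the Yang–Mills input).  The two lemmas below are the
abstract content of obstruction (d): subsequential convergence is not convergence, and per-parameter
subsequences over an uncountable parameter set have no common refinement.  A proof must therefore add
(U) uniqueness of the continuum limit in the cone, or (E) equicontinuity in `m` uniformly in `k` (after
`m`-dependent species renormalisation `z(m,k), shift(m,k)`, which the conclusion allows) plus a diagonal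
extraction over a countable dense set of mass tuples — neither is in the hypotheses. -/

section Subsequences

open Filter Topology

/-- **Subsequential convergence is not convergence**: `k ↦ k mod 2` converges along the even numbers and
does not converge.  (`RobustYangMills` gives the former along a `W`-dependent `φ`; `IsQCDAlong` wants the
latter.) [folklore] -/
theorem subseq_tendsto_not_tendsto :
    ∃ x : ℕ → ℝ, (∃ φ : ℕ → ℕ, StrictMono φ ∧ Tendsto (x ∘ φ) atTop (𝓝 0)) ∧
      ¬ ∃ c, Tendsto x atTop (𝓝 c) := by
  refine ⟨fun k => ((k % 2 : ℕ) : ℝ), ⟨fun j => 2 * j, fun a b h => show 2 * a < 2 * b by omega, ?_⟩, ?_⟩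
  · refine tendsto_const_nhds.congr fun j => ?_
    simp [Function.comp]
  · rintro ⟨c, hc⟩
    have h0 : Tendsto (fun j : ℕ => ((2 * j % 2 : ℕ) : ℝ)) atTop (𝓝 c) :=
      hc.comp (StrictMono.tendsto_atTop (fun a b h => by omega))
    have h1 : Tendsto (fun j : ℕ => (((2 * j + 1) % 2 : ℕ) : ℝ)) atTop (𝓝 c) :=
      hc.comp (StrictMono.tendsto_atTop (fun a b h => by omega))
    have e0 : (fun j : ℕ => ((2 * j % 2 : ℕ) : ℝ)) = fun _ => 0 := by funext j; simp
    have e1 : (fun j : ℕ => (((2 * j + 1) % 2 : ℕ) : ℝ)) = fun _ => 1 := by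
      funext j; simp [Nat.add_mod]
    rw [e0] at h0
    rw [e1] at h1
    have hc0 : c = 0 := (tendsto_nhds_unique tendsto_const_nhds h0).symm ▸ rfl
    have hc1 : c = 1 := (tendsto_nhds_unique tendsto_const_nhds h1).symm ▸ rfl
    linarith

/-- **No common subsequence.** A `{0,1}`-valued family `x p` indexed by the uncountably many
`p : ℕ → Bool` (standing for the mass tuples `m`, each with its own effective `W_m`): every member has a
convergent subsequence along every subsequence (Bolzano–Weierstrass — what a compactness-type hypothesis
delivers parameter by parameter), yet for EVERY strictly monotone `φ` some member fails to converge
along `φ` (take `p` = the indicator of the even-indexed values of `φ`).  So "for each `m` a good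
subsequence" never yields "one `reg` good for all `m`" without uniqueness of the limits or continuity in
the parameter. [folklore] -/
theorem no_common_subsequence :
    ∃ x : (ℕ → Bool) → ℕ → ℝ, (∀ p k, x p k = 0 ∨ x p k = 1) ∧
      (∀ p, ∀ φ : ℕ → ℕ, StrictMono φ → ∃ ψ : ℕ → ℕ, StrictMono ψ ∧
        ∃ c, Tendsto (fun k => x p (φ (ψ k))) atTop (𝓝 c)) ∧
      ∀ φ : ℕ → ℕ, StrictMono φ → ∃ p, ¬ ∃ c, Tendsto (fun k => x p (φ k)) atTop (𝓝 c) := by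
  classical
  refine ⟨fun p k => if p k then 1 else 0, fun p k => by by_cases h : p k <;> simp [h], ?_, ?_⟩
  · intro p φ _hφ
    have hs : Bornology.IsBounded ({0, 1} : Set ℝ) := (Set.toFinite _).isBounded
    have hx : ∀ k, (fun k => if p (φ k) then (1 : ℝ) else 0) k ∈ ({0, 1} : Set ℝ) := fun k => by
      by_cases h : p (φ k) <;> simp [h]
    obtain ⟨a, -, ψ, hψ, hlim⟩ := tendsto_subseq_of_bounded hs hx
    exact ⟨ψ, hψ, a, hlim⟩
  · intro φ hφ
    let p : ℕ → Bool := fun n => decide (∃ j, n = φ (2 * j))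
    refine ⟨p, ?_⟩
    rintro ⟨c, hc⟩
    have h0 : Tendsto (fun j : ℕ => if p (φ (2 * j)) then (1 : ℝ) else 0) atTop (𝓝 c) :=
      hc.comp (StrictMono.tendsto_atTop (fun a b h => by omega))
    have h1 : Tendsto (fun j : ℕ => if p (φ (2 * j + 1)) then (1 : ℝ) else 0) atTop (𝓝 c) :=
      hc.comp (StrictMono.tendsto_atTop (fun a b h => by omega))
    have e0 : (fun j : ℕ => if p (φ (2 * j)) then (1 : ℝ) else 0) = fun _ => 1 := by
      funext j
      have : p (φ (2 * j)) = true := by simp only [p, decide_eq_true_eq]; exact ⟨j, rfl⟩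
      simp [this]
    have e1 : (fun j : ℕ => if p (φ (2 * j + 1)) then (1 : ℝ) else 0) = fun _ => 0 := by
      funext j
      have : p (φ (2 * j + 1)) = false := by
        simp only [p, decide_eq_false_iff_not, not_exists]
        intro i h
        have := hφ.injective h
        omega
      simp [this]
    rw [e0] at h0
    rw [e1] at h1
    have hc0 : c = 1 := tendsto_nhds_unique h0 tendsto_const_nhds ▸ rfl
    have hc1 : c = 0 := tendsto_nhds_unique h1 tendsto_const_nhds ▸ rfl
    linarith

end Subsequences

/-! ## §7 Audit of the eight round-1 crux-idea cards' first lemmas (cycle 2)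

Sources: `Cruxes/SeaFactorisationBridge/SketchIdeator3.lean` (cards degenerate-doublet-anchor = A,
condition-then-quench = B, average-the-dissection = C), `SketchIdeator2.lean` (twisted-elliptic-splitting,
superconfinement-carry, impedance-coordinates), and the card texts of proper-time-quarantine /
uv-sign-erasure (ideator 1's `Sketch.lean` sits on the gate box, unreadable from the hub).  Verdicts
(paper proofs sketched; nothing here is a target yet — no line picked):

* A3 `PairingDefectForcesWindowCrossing` — THEOREM: `t ↦ det wilsonCell U t x s` is a real polynomial
  (cells are `γ₅`-hermitian, `DirichletDetReal`); a negative product at `μ ± δ` means opposite signs, so a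
  zero strictly inside `(μ−δ, μ+δ)` (IVT).  Degenerate boxes (empty interior) have determinant `1`, product
  `1 > 0`: hypothesis false, fine.
* A4 `ResonantCellSingularSeparator` — THEOREM with room.  With `v ≠ 0`, `‖D_c v‖ < w‖v‖`, children
  `κ`-coercive and `w < κ`: `v_Σ ≠ 0` (else `‖D_c v‖ ≥ ‖D_II v_I‖ ≥ κ‖v‖ > w‖v‖`); the harmonic correction
  `x = v − (0 ⊕ D_II⁻¹ (D_c v)_I)` has `x_Σ = v_Σ`, `(D_c x)_I = 0`,
  `‖(D_c x)_Σ‖ ≤ (1 + 4/κ) w ‖v‖` and `‖v‖ ≤ (1 + 4/κ)/(1 − w/κ) ‖v_Σ‖`, i.e. level `w(1+4/κ)²/(1−w/κ)`,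
  below the card's `w(1+8/κ)²/(1−w/κ)` (`HasSingularSeparator.mono`).  Here `4` = operator norm of the
  Wilson hopping (each direction's `P₋U T + P₊U†T†` is unitary in the tree's normalisation; tree lemma
  `l2_opNorm_sum_wilsonHop_le`, the one behind the sibling's `|m+4| > 4` positivity bound and `KineticEdge`).  `s i ≤ N` excludes wrap-around; empty
  children make the coercivity hypothesis vacuous and `D_II` a `0 × 0` block — claim still true.
* B3 `SignedBlockSeaDominates` — THEOREM (B2 `condQuench_lower` on each `B⁻¹A`, plus
  `∫σw = ∫w − 2∫b ≤ ∫w` from `b ≥ 0`).  Its hypothesis `p < ½` PER BLOCK EVENT is a rate the hinge does not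
  supply: `half_defect_mass_zero_sign` (§2) is its tightness.
* C2 `UVSeparatorActivityBound` — THEOREM as stated, with a slip that does not bite.  `τ > 0` and
  `τ − μ ≤ K(s) := Σ_i (1 − cos(π/s_i))` force `μ > −K(s) ≥ −K(child)` for every child, so by
  `KineticEdge` (a) no child is singular (`IsUnit`), and `Re⟨v_Σ, S_Σ v_Σ⟩ = Re⟨ṽ, D_c ṽ⟩ ≥ (μ+K(s))‖ṽ‖² ≥
  τ‖v_Σ‖²` (`ṽ` the harmonic extension; `μ + K(s) > 0` is what licenses `‖ṽ‖ ≥ ‖v_Σ‖`) gives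
  `σ_min(S_Σ) ≥ τ`, hence `τ^{|Σ|} ≤ |det S_Σ|`.  Upper bound: the children-floor hypothesis is written with
  `⌊s_i/2⌋` although half of the children have side `⌈s_i/2⌉` (weaker floor); the honest bound is
  `‖S_Σ‖ ≤ |μ+4| + 4 + 16/σ_min(D_II)` with `σ_min(D_II) ≥ μ + Σ_i(1 − cos(π/⌈s_i/2⌉))`, and
  `8 + |μ| + 64/τ′` still dominates throughout the admissible range (violation would need
  `μ + K_⌈⌉ < (μ + K_⌊⌋)/4`, i.e. `μ < −2.67, −1.33, −0.9` for `s = 3, 5, 7` and `μ ≲ −(8/3)π²/s²`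
  asymptotically, all excluded by `μ > −K(s) = −2, −0.76, −0.40, −2π²/s²`).  Suggested repair anyway:
  write the children floor with `s i − s i / 2`.
* `TwistedSplittingBound` — THEOREM (`Q = Γ₅D` hermitian; `(Q+iτ)(Q−iτ) = Q²+τ² > 0`; `|det Γ₅| = 1`;
  `|det D|² = ∏ q_j² ≤ ∏ (q_j²+τ²)`).  Caveat for the line, not a refutation: `log|F_τ| =
  −½ Σ_j log(1 + τ²/q_j²) ≍ −½ τ² Tr Q⁻²` is EXTENSIVE at fixed `τ`, so the "bounded resonance/sign field"
  `F_τ ∈ [−1, 1]` has Kotecký–Preiss activities `O(1)` per cell before a cell-wise renormalisation;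
  smallness = rarity of `|q_j| ≲ τ` = a rate (as for every other card).
* `SlabGapTransfer` — NOT decidable here (Wilson measures).  No junk instance: `t = 0`, `S = 0` are
  absorbed by `∃ C ≥ 2`, `b = 0` by `∃ n₀ > 0`, `W = 0` reduces to the hypothesis with `C ≥ 1`, `β ≤ 0` only
  through the hypothesis.  Status as mathematics: L²-slab mixing of a finite-range (Markov) reference
  measure in all four directions + a sup-small block perturbation at `b ≫ 1/Δ` is the setting of block
  cluster expansions / restricted complete analyticity (Olivieri–Picco, Martinelli–Olivieri); the known
  `d ≥ 3` pathology (Martinelli–Olivieri–Schonmann 1994: strong mixing for cubes ⇏ general shapes)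
  concerns shapes with boundary conditions, not full torus slabs — it does not bite as stated.  The burden
  §8 puts on THIS card: its use of `RobustYangMills` at `W ≡ 0` compares Wilson measures at couplings
  `β′_k` and `reg.β_k` that are `(N_f/12π²) log a_k⁻²` apart at the same `k`.
* `SeparatorSheetMarkov` — THEOREM (exact algebra: `S_Σ = D_ΣΣ − D_ΣI D_II⁻¹ D_IΣ` reads the links with an
  endpoint on `Σ` and the `Σ`-adjacent entries of `D_II⁻¹` only, by nearest-neighbour support; Lean's junk
  inverse is the same on both sides of the hypothesis).
* `stub_vUniformDefectRarity_shape` (`∃ δ ≥ 0, VUniformDefectRarity … δ`) — VACUOUS at `δ = 1`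
  (indicator `≤ 1`; every integrand is bounded measurable on a compact link space under a probability
  measure, so no Bochner junk).  The content is only in the route-shaped version (`Σ_j δ_j ≤ ε` uniformly in
  the fibre weight `φ`), undecidable here; "for every `V`" (the card's own flagged risk) is not attackable
  in Lean.  The card's displayed bound `E[σ | V] ≥ exp(−2(1+ε) E[#defects | V])` is an independence-type
  inequality, FALSE without the conditional-decorrelation input: `sign_lowerBound_needs_decorrelation`
  below; `stub_signProduct_lowerBound` (independent case) is `independent_defects_sign_average` (§2) in
  equality form.
* proper-time-quarantine's Frullani stubs — shape only (card); the split of `log|det| = ½ Tr log(D†D)` at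
  `t₀` is sound (accretive `D†D`; the IR half carries the zero modes, `e^{−N_f W_IR} ∈ (0, 1]`), nothing to
  refute at stub level. -/

section CardAudit

open Finset

/-- **uv-sign-erasure's sign bound needs its decorrelation input.**  On the cycle-1 model (no defect
with probability `½`, one uniformly placed defect with probability `½`; one-cell marginals `1/(2n)`) the
expected number of defects is `Σ_i P(defect at i) = ½` while the mean sign is `0`, which is STRICTLY
BELOW `exp(−2(1+ε)·½)` for every `ε`: the displayed inequality `E[σ | V] ≥ exp(−2(1+ε) E[#defects | V])`
is false for correlated defects however dilute the marginals. [folklore] -/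
theorem sign_lowerBound_needs_decorrelation (n : ℕ) (hn : 0 < n) (ε : ℝ) :
    ∃ p : Option (Fin n) → ℝ, (∀ c, 0 ≤ p c) ∧ ∑ c, p c = 1 ∧
      (∀ i : Fin n, p (some i) = 1 / (2 * n)) ∧ ∑ i : Fin n, p (some i) = 1 / 2 ∧
      ∑ c, p c * oneDefectSign c < Real.exp (-(2 * (1 + ε)) * ∑ i : Fin n, p (some i)) := by
  obtain ⟨p, h0, h1, hmarg, hhalf, hsign⟩ := half_defect_mass_zero_sign n hn
  exact ⟨p, h0, h1, hmarg, hhalf, by rw [hsign]; exact Real.exp_pos _⟩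

end CardAudit

/-! ## §8 The coupling mismatch: `RobustYangMills` lives on pure-gauge two-loop profiles, the
conclusion on the `N_f`-flavour profile of the same scheme (cycle 2; over the tree's `afBeta`,
`betaCoeff₀`, `betaCoeff₁`)

`RobustYangMills` quantifies over coupling sequences with `β′_k − afBeta 0 Λ′ a_k → 0`; `IsQCDAlong
(reg.scheme m z shift) T` contains `(reg.scheme …).HasAsymptoticScaling`, i.e. `reg.β_k − afBeta N_f Λ a_k →
0` for some `Λ > 0`, along the SAME spacings `reg.a`.  Physics: integrating out `N_f` heavy flavours shifts
the inverse bare coupling by the screening logarithm — the two `Λ`-parameters are related by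
`Λ_ℓ/Λ_q = P(M/Λ_q)` up to `O((Λ/M)²)` (Athenodorou–Finkenrath–Knechtli–Korzec–Leder–Marinković–Sommer,
Nucl. Phys. B 943 (2019) 114612 = arXiv:1809.03383, §3).  The lemmas make the size and the required
PRECISION of that shift a checked statement about the tree's profiles. -/

section CouplingMismatch

open Filter Topology Asymptotics

/-- `b₀(0) > b₀(N_f)` for `N_f ≥ 1`: quarks screen. [folklore] -/
theorem betaCoeff₀_zero_sub_pos {Nf : ℕ} (h : 1 ≤ Nf) : 0 < betaCoeff₀ 0 - betaCoeff₀ Nf := by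
  unfold betaCoeff₀
  have hN : (1 : ℝ) ≤ Nf := by exact_mod_cast h
  have hπ : 0 < 16 * Real.pi ^ 2 := by positivity
  rw [← sub_div]
  apply div_pos _ hπ
  simp only [Nat.cast_zero]
  linarith

/-- The one-loop size of the mismatch: `2 (b₀(0) − b₀(N_f)) = N_f / (12 π²)` — the coefficient of
`log a_k⁻²` in the coupling shift the bridge must extract from the sea (heavy-quark screening in the
tree's normalisation `β = 2/g₀²`). [folklore] -/
theorem two_mul_betaCoeff₀_zero_sub (Nf : ℕ) :
    2 * (betaCoeff₀ 0 - betaCoeff₀ Nf) = Nf / (12 * Real.pi ^ 2) := by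
  unfold betaCoeff₀
  have hπ : Real.pi ≠ 0 := Real.pi_ne_zero
  simp only [Nat.cast_zero]
  field_simp
  ring

/-- **The two asymptotic-freedom profiles drift apart.** For `N_f ≥ 1`, any `Λ, Λ' > 0` and any
spacings `a_k → 0⁺`: `afBeta 0 Λ' a_k − afBeta N_f Λ a_k → +∞` (it is `(N_f/12π²) log a_k⁻² + o(log a_k⁻²)`).
[folklore] -/
theorem tendsto_afBeta_zero_sub_afBeta_atTop {Nf : ℕ} (hNf : 1 ≤ Nf) {Λ Λ' : ℝ} (hΛ : 0 < Λ)
    (hΛ' : 0 < Λ') {a : ℕ → ℝ} (ha : ∀ k, 0 < a k) (ha0 : Tendsto a atTop (𝓝 0)) :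
    Tendsto (fun k => afBeta 0 Λ' (a k) - afBeta Nf Λ (a k)) atTop atTop := by
  -- L k = log (a_k⁻²) → ∞
  set L : ℕ → ℝ := fun k => Real.log ((a k ^ 2)⁻¹) with hLdef
  have hlog : ∀ M : ℝ, 0 < M → ∀ k, Real.log (1 / (a k ^ 2 * M ^ 2)) = L k + Real.log ((M ^ 2)⁻¹) := by
    intro M hM k
    rw [one_div, mul_inv,
      Real.log_mul (inv_ne_zero (pow_ne_zero 2 (ha k).ne')) (inv_ne_zero (pow_ne_zero 2 hM.ne'))]
  have hL : Tendsto L atTop atTop := by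
    have h1 : Tendsto (fun k => a k ^ 2) atTop (𝓝[>] 0) := by
      refine tendsto_nhdsWithin_iff.2 ⟨?_, Eventually.of_forall fun k => pow_pos (ha k) 2⟩
      simpa using ha0.pow 2
    exact Real.tendsto_log_atTop.comp (tendsto_inv_nhdsGT_zero.comp h1)
  have hnorm : Tendsto (fun k => ‖L k‖) atTop atTop := tendsto_norm_atTop_atTop.comp hL
  have hconst : ∀ c : ℝ, (fun _ : ℕ => c) =o[atTop] L := fun c =>
    isLittleO_const_left.2 (Or.inr hnorm)
  have hlogL : ∀ c : ℝ, (fun k => Real.log (L k + c)) =o[atTop] L := by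
    intro c
    have ht : Tendsto (fun k => L k + c) atTop atTop := tendsto_atTop_add_const_right _ c hL
    have h1 : (fun k => Real.log (L k + c)) =o[atTop] (fun k => L k + c) :=
      Real.isLittleO_log_id_atTop.comp_tendsto ht
    have h2 : (fun k => L k + c) =O[atTop] L := (isBigO_refl L atTop).add (hconst c).isBigO
    exact h1.trans_isBigO h2
  -- the decomposition D = A·L + g with g = o(L)
  set A : ℝ := 2 * (betaCoeff₀ 0 - betaCoeff₀ Nf) with hA
  have hApos : 0 < A := by rw [hA]; exact mul_pos two_pos (betaCoeff₀_zero_sub_pos hNf)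
  set cΛ : ℝ := Real.log ((Λ ^ 2)⁻¹)
  set cΛ' : ℝ := Real.log ((Λ' ^ 2)⁻¹)
  set g : ℕ → ℝ := fun k => (2 * betaCoeff₀ 0 * cΛ' - 2 * betaCoeff₀ Nf * cΛ) +
      2 * (betaCoeff₁ 0 / betaCoeff₀ 0) * Real.log (L k + cΛ') -
        2 * (betaCoeff₁ Nf / betaCoeff₀ Nf) * Real.log (L k + cΛ) with hg
  have hgo : g =o[atTop] L :=
    ((hconst _).add ((hlogL cΛ').const_mul_left _)).sub ((hlogL cΛ).const_mul_left _)
  have hgA : g =o[atTop] (fun k => A * L k) := (isLittleO_const_mul_right_iff hApos.ne').2 hgo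
  have hequiv : (fun k => A * L k + g k) ~[atTop] (fun k => A * L k) :=
    IsEquivalent.refl.add_isLittleO hgA
  have hAL : Tendsto (fun k => A * L k) atTop atTop := hL.const_mul_atTop hApos
  have hmain : Tendsto (fun k => A * L k + g k) atTop atTop := hequiv.symm.tendsto_atTop hAL
  refine hmain.congr fun k => ?_
  simp only [afBeta, hlog Λ hΛ k, hlog Λ' hΛ' k, hg, hA]
  ring

/-- **Incompatible scalings.** For `N_f ≥ 1` NO coupling sequence `β_k` follows both the `N_f`-flavour
and the pure-gauge two-loop profile along the same spacings. [folklore] -/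
theorem not_both_asymptotic_scalings {Nf : ℕ} (hNf : 1 ≤ Nf) {a : ℕ → ℝ} (ha : ∀ k, 0 < a k)
    (ha0 : Tendsto a atTop (𝓝 0)) (β : ℕ → ℝ) {Λ Λ' : ℝ} (hΛ : 0 < Λ) (hΛ' : 0 < Λ')
    (hN : Tendsto (fun k => β k - afBeta Nf Λ (a k)) atTop (𝓝 0)) :
    ¬ Tendsto (fun k => β k - afBeta 0 Λ' (a k)) atTop (𝓝 0) := by
  intro h0
  have hdiff := hN.sub h0
  have heq : (fun k => (β k - afBeta Nf Λ (a k)) - (β k - afBeta 0 Λ' (a k))) =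
      fun k => afBeta 0 Λ' (a k) - afBeta Nf Λ (a k) := by
    funext k; ring
  rw [heq, sub_zero] at hdiff
  exact not_tendsto_nhds_of_tendsto_atTop
    (tendsto_afBeta_zero_sub_afBeta_atTop hNf hΛ hΛ' ha ha0) 0 hdiff

/-- **Scheme level.** If the QCD scheme of the conclusion scales asymptotically (as `IsQCDAlong`
demands), its OWN couplings `reg.β` follow no pure-gauge profile: `RobustYangMills` can only be invoked at
shifted couplings `β′ ≠ reg.β`.  The natural strengthening of the bridge "apply the Yang–Mills input at
the QCD scheme's couplings" has a false premise for every `Λ′`. [folklore] -/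
theorem scheme_beta_not_pureGauge {Nf : ℕ} (hNf : 1 ≤ Nf) (reg : QCDRegularisation Nf)
    (m : Fin Nf → ℝ) (z shift : QCDField Nf → ℕ → ℝ)
    (h : (reg.scheme m z shift).HasAsymptoticScaling) {Λ' : ℝ} (hΛ' : 0 < Λ') :
    ¬ Tendsto (fun k => reg.β k - afBeta 0 Λ' (reg.a k)) atTop (𝓝 0) := by
  obtain ⟨Λ, hΛ, hN⟩ := h
  exact not_both_asymptotic_scalings hNf reg.a_pos reg.tendsto_a reg.β hΛ hΛ' hN

/-- The same, read off the conclusion's `IsQCDAlong` clause directly. [folklore] -/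
theorem isQCDAlong_beta_not_pureGauge {Nf : ℕ} (hNf : 1 ≤ Nf) (reg : QCDRegularisation Nf)
    (m : Fin Nf → ℝ) (z shift : QCDField Nf → ℕ → ℝ) (T : OSData (QCDField Nf) 4)
    (h : IsQCDAlong (reg.scheme m z shift) T) {Λ' : ℝ} (hΛ' : 0 < Λ') :
    ¬ Tendsto (fun k => reg.β k - afBeta 0 Λ' (reg.a k)) atTop (𝓝 0) :=
  scheme_beta_not_pureGauge hNf reg m z shift h.1 hΛ'

/-- **The hand-over shift diverges**: if `β` scales with the `N_f` profile and `β′` with the pure-gauge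
profile along the same spacings, then `β′_k − β_k → +∞`. [folklore] -/
theorem shift_tendsto_atTop {Nf : ℕ} (hNf : 1 ≤ Nf) {a : ℕ → ℝ} (ha : ∀ k, 0 < a k)
    (ha0 : Tendsto a atTop (𝓝 0)) (β β' : ℕ → ℝ) {Λ Λ' : ℝ} (hΛ : 0 < Λ) (hΛ' : 0 < Λ')
    (hN : Tendsto (fun k => β k - afBeta Nf Λ (a k)) atTop (𝓝 0))
    (h0 : Tendsto (fun k => β' k - afBeta 0 Λ' (a k)) atTop (𝓝 0)) :
    Tendsto (fun k => β' k - β k) atTop atTop := by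
  have h := tendsto_afBeta_zero_sub_afBeta_atTop hNf hΛ hΛ' ha ha0
  have h2 : Tendsto (fun k => (β' k - afBeta 0 Λ' (a k)) - (β k - afBeta Nf Λ (a k))) atTop
      (𝓝 (0 - 0)) :=
    h0.sub hN
  rw [sub_zero] at h2
  have h3 := h.atTop_add h2
  refine h3.congr fun k => ?_
  ring

/-- **Two-loop mismatch, `N_f = 2`:** the `log log` coefficient `b₁/b₀` of the two-flavour profile is
STRICTLY below the pure-gauge one (`230/29 < 102/11` in units of `1/16π²`). [folklore] -/
theorem betaRatio_two_lt_zero : betaCoeff₁ 2 / betaCoeff₀ 2 < betaCoeff₁ 0 / betaCoeff₀ 0 := by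
  unfold betaCoeff₀ betaCoeff₁
  have hπ : 0 < Real.pi ^ 2 := by positivity
  simp only [Nat.cast_zero, Nat.cast_ofNat]
  rw [div_lt_div_iff₀ (by positivity) (by positivity), div_mul_div_comm, div_mul_div_comm,
    div_lt_div_iff_of_pos_right (by positivity)]
  norm_num

/-- **Two-loop mismatch, `N_f = 3`:** `64/9 < 102/11`. [folklore] -/
theorem betaRatio_three_lt_zero : betaCoeff₁ 3 / betaCoeff₀ 3 < betaCoeff₁ 0 / betaCoeff₀ 0 := by
  unfold betaCoeff₀ betaCoeff₁
  have hπ : 0 < Real.pi ^ 2 := by positivity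
  simp only [Nat.cast_zero, Nat.cast_ofNat]
  rw [div_lt_div_iff₀ (by positivity) (by positivity), div_mul_div_comm, div_mul_div_comm,
    div_lt_div_iff_of_pos_right (by positivity)]
  norm_num

/-- **The shift must be two-loop exact.** Even after subtracting the exact one-loop counterterm
`(N_f/12π²) log a_k⁻²` and ANY constant `C` (the freedom `Λ′(Λ, M, N_f)`), the mismatch of the two
profiles still diverges, like `2 (b₁(0)/b₀(0) − b₁(N_f)/b₀(N_f)) log log a_k⁻²`, whenever
`b₁(N_f)/b₀(N_f) < b₁(0)/b₀(0)` (the case `N_f = 2, 3`: `betaRatio_two_lt_zero`, `betaRatio_three_lt_zero`).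
So the coupling hand-over `β′_k` of the bridge must reproduce the sea's contribution to the running
coupling with TWO-LOOP accuracy and `o(1)` error in `β = 2/g₀²`:
`β′_k = reg.β_k + (N_f/12π²) log a_k⁻² + 2(b₁⁰/b₀⁰ − b₁ᴺ/b₀ᴺ) log log a_k⁻² + C + o(1)`. [folklore] -/
theorem residual_after_oneLoop_shift_tendsto_atTop {Nf : ℕ}
    (hr : betaCoeff₁ Nf / betaCoeff₀ Nf < betaCoeff₁ 0 / betaCoeff₀ 0) {Λ Λ' : ℝ} (hΛ : 0 < Λ)
    (hΛ' : 0 < Λ') {a : ℕ → ℝ} (ha : ∀ k, 0 < a k) (ha0 : Tendsto a atTop (𝓝 0)) (C : ℝ) :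
    Tendsto (fun k => afBeta 0 Λ' (a k) - afBeta Nf Λ (a k) -
      (2 * (betaCoeff₀ 0 - betaCoeff₀ Nf) * Real.log ((a k ^ 2)⁻¹) + C)) atTop atTop := by
  set L : ℕ → ℝ := fun k => Real.log ((a k ^ 2)⁻¹) with hLdef
  have hlog : ∀ M : ℝ, 0 < M → ∀ k, Real.log (1 / (a k ^ 2 * M ^ 2)) = L k + Real.log ((M ^ 2)⁻¹) := by
    intro M hM k
    rw [one_div, mul_inv,
      Real.log_mul (inv_ne_zero (pow_ne_zero 2 (ha k).ne')) (inv_ne_zero (pow_ne_zero 2 hM.ne'))]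
  have hL : Tendsto L atTop atTop := by
    have h1 : Tendsto (fun k => a k ^ 2) atTop (𝓝[>] 0) := by
      refine tendsto_nhdsWithin_iff.2 ⟨?_, Eventually.of_forall fun k => pow_pos (ha k) 2⟩
      simpa using ha0.pow 2
    exact Real.tendsto_log_atTop.comp (tendsto_inv_nhdsGT_zero.comp h1)
  -- log (L + c) - log L → 0
  have hsmall : ∀ c : ℝ, Tendsto (fun k => Real.log (L k + c) - Real.log (L k)) atTop (𝓝 0) := by
    intro c
    have hq : Tendsto (fun k => (L k + c) / L k) atTop (𝓝 1) := by
      have h1 : Tendsto (fun k => 1 + c / L k) atTop (𝓝 (1 + 0)) :=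
        tendsto_const_nhds.add (tendsto_const_nhds.div_atTop hL)
      rw [add_zero] at h1
      refine h1.congr' ?_
      filter_upwards [hL.eventually_gt_atTop 0] with k hk
      field_simp
    have hlog1 : Tendsto (fun k => Real.log ((L k + c) / L k)) atTop (𝓝 0) := by
      simpa [Real.log_one] using hq.log one_ne_zero
    refine hlog1.congr' ?_
    filter_upwards [hL.eventually_gt_atTop |c|] with k hk
    have hLk : 0 < L k := lt_of_le_of_lt (abs_nonneg c) hk
    have hLc : 0 < L k + c := by
      have := neg_abs_le c
      linarith
    rw [Real.log_div hLc.ne' hLk.ne']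
  set r0 : ℝ := betaCoeff₁ 0 / betaCoeff₀ 0
  set rN : ℝ := betaCoeff₁ Nf / betaCoeff₀ Nf
  set cΛ : ℝ := Real.log ((Λ ^ 2)⁻¹)
  set cΛ' : ℝ := Real.log ((Λ' ^ 2)⁻¹)
  have hmain : Tendsto (fun k => 2 * (r0 - rN) * Real.log (L k)) atTop atTop :=
    (Real.tendsto_log_atTop.comp hL).const_mul_atTop (by linarith : 0 < 2 * (r0 - rN))
  have hrest : Tendsto (fun k => (2 * betaCoeff₀ 0 * cΛ' - 2 * betaCoeff₀ Nf * cΛ - C) +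
      2 * r0 * (Real.log (L k + cΛ') - Real.log (L k)) -
        2 * rN * (Real.log (L k + cΛ) - Real.log (L k))) atTop
      (𝓝 ((2 * betaCoeff₀ 0 * cΛ' - 2 * betaCoeff₀ Nf * cΛ - C) + 2 * r0 * 0 - 2 * rN * 0)) :=
    (tendsto_const_nhds.add ((hsmall cΛ').const_mul _)).sub ((hsmall cΛ).const_mul _)
  have h := hmain.atTop_add hrest
  refine h.congr fun k => ?_
  simp only [afBeta, hlog Λ hΛ k, hlog Λ' hΛ' k]
  ring


/-- **One-loop matching is not enough (scheme level).** If `β` scales with the `N_f`-flavour profile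
(`N_f = 2, 3`, or any `N_f` with `b₁(N_f)/b₀(N_f) < b₁(0)/b₀(0)`), then the one-loop-shifted couplings
`β′_k := β_k + (N_f/12π²) log a_k⁻² + C` follow NO pure-gauge profile: for every `Λ′ > 0` and every
constant `C`, `β′_k − afBeta 0 Λ′ a_k → −∞`.  The hand-over couplings of the bridge need the two-loop
`log log` term as well. [folklore] -/
theorem oneLoop_shift_not_pureGauge {Nf : ℕ}
    (hr : betaCoeff₁ Nf / betaCoeff₀ Nf < betaCoeff₁ 0 / betaCoeff₀ 0) {a : ℕ → ℝ} (ha : ∀ k, 0 < a k)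
    (ha0 : Tendsto a atTop (𝓝 0)) (β : ℕ → ℝ) {Λ Λ' : ℝ} (hΛ : 0 < Λ) (hΛ' : 0 < Λ')
    (hN : Tendsto (fun k => β k - afBeta Nf Λ (a k)) atTop (𝓝 0)) (C : ℝ) :
    Tendsto (fun k => (β k + (2 * (betaCoeff₀ 0 - betaCoeff₀ Nf) * Real.log ((a k ^ 2)⁻¹) + C)) -
      afBeta 0 Λ' (a k)) atTop atBot := by
  have h := residual_after_oneLoop_shift_tendsto_atTop hr hΛ hΛ' ha ha0 C
  have hneg : Tendsto (fun k => -(afBeta 0 Λ' (a k) - afBeta Nf Λ (a k) -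
      (2 * (betaCoeff₀ 0 - betaCoeff₀ Nf) * Real.log ((a k ^ 2)⁻¹) + C))) atTop atBot :=
    tendsto_neg_atTop_atBot.comp h
  have h2 := hN.add_atBot hneg
  refine h2.congr fun k => ?_
  ring

end CouplingMismatch

end Summit.QuantumFields.QCD.Cruxes.SeaFactorisationBridge.Disproof

end
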